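import Literature.Analysis.FunctionSpaces.PoissonPointProcess
import Mathlib.Analysis.InnerProductSpace.PiL2
import Mathlib.MeasureTheory.Constructions.Pi
import Mathlib.MeasureTheory.Measure.Haar.OfBasis
import Mathlib.Topology.MetricSpace.Bounded
import HarnessLib

/-!
# Barrier: thermal motion forbids positional (crystalline) order in two dimensions — every Gibbs
# measure of the hard-disk model is translation invariant (Richthammer 2007, Theorem 1)

Topic: `Literature/Barriers/AtomisticToContinuum` (barrier catalogue of
`AtomisticToContinuum/Crystallization`, D-0021; seat 2, seed "only 2D results (Theil)").
The two-dimensional crystallization theorems (Theil 2006; Heitmann–Radin; E–Li; De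
Luca–Friesecke) are statements at temperature ZERO. At any positive temperature the
two-dimensional picture is the opposite: "The properties of the system in the thermodynamic limit
depend in a crucial way on the space dimension `d`, a phenomenon that is not present at `T = 0` …
A similar result called the Mermin-Wagner theorem [Mermin 1968, Fröhlich–Pfister 1981, 1986]
exists in two dimensions for very short-range potentials, except that only the
translation-invariance is known … Given that there is no crystalline order in one and
two-dimensional systems at positive temperature, but that crystallization is expected at `T = 0`
…" (Blanc–Lewin 2015, §3.1, arXiv p. 18). This file vendors the sharpest printed instance, for
the model closest to sphere packing.

## The result, as printed (Richthammer, Comm. Math. Phys. 274 (2007) 81–122, §2 Theorem 1)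

"Let `z > 0` be an activity parameter, `|.|_h` be a norm on `ℝ²` and `U_hc` be the corresponding
pure hard-core potential. Then every Gibbs measure corresponding to `U_hc` and `z` is
translation-invariant." Setting (§3): configurations are the locally finite subsets of `ℝ²` with
the σ-algebra generated by the counting variables `N_Λ`; the reference measure `ν_Λ(·|X̄)` is the
Poisson process in the bounded Borel set `Λ` superposed with the boundary condition `X̄_{Λᶜ}`,
`∫ ν_Λ(dX|X̄) f(X) = e^{-λ²(Λ)} ∑_{k ≥ 0} (1/k!) ∫_{Λ^k} f({x₁,…,x_k} ∪ X̄_{Λᶜ}) dx`; the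
conditional Gibbs distribution is `γ_Λ(A|X̄) = Z_Λ(X̄)⁻¹ ∫ ν_Λ(dX|X̄) e^{-H_Λ(X)} z^{#X_Λ} 1_A(X)`
with `H_Λ(X) = ∑_{x x' ∈ E_Λ(X)} U(x - x')` summed over the pairs meeting `Λ`, i.e. for the pure hard
core `e^{-H_Λ(X)} = 1` iff no two points of `X`, one of which lies in `Λ`, are at `|.|_h`-distance
`≤ 1`; and "`μ ∈ 𝒢(U, z) ⟺ (μ ⊗ γ_Λ = μ ∀ Λ ∈ ℬ²_b)`", `(μ ⊗ γ_Λ)(A) = ∫ μ(dX̄) γ_Λ(A|X̄)`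
(§3.3, (3.1)). The refinement Richthammer 2016 (Comm. Math. Phys., arXiv:1504.08147, Theorem 1
and Corollary 1): in the box `[-n, n]²` with arbitrary hard-core boundary condition the particles
near the centre can be displaced by `δε√(log n)` at bounded cost, so "the mean square displacement
of particles near the center of the box is bounded from below by `c log n`" — "the hard disk model
shows the same behaviour as the harmonic crystal" (Peierls).

## Lean rendering (namespace `Literature.StatMech.HardDisk`; Euclidean norm, disc diameter `1`)

* `superpose Λ x Y` — the configuration `({x₁,…,x_k} ∩ Λ) ∪ (Y ∩ Λᶜ)` (tree `Literature.Analysis.FunctionSpaces.PointConfig`);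
* `HardCoreIn Λ X` — `e^{-H_Λ(X)} = 1`: points of `X` at mutual distance `≤ 1` never meet `Λ`;
* `weight z Λ Y A = ∑_k (z^k/k!) ∫_{Λ^k} 1_A 1_{HardCoreIn Λ} (superpose Λ x Y) dx` (an
  `ℝ≥0∞`-valued lower Lebesgue integral — no measurability is presupposed, the integrand being
  measurable by Richthammer §3.3; the structure-independent factor `e^{-λ²(Λ)}` is dropped, and
  `z^{#X_Λ} = z^k` off the null set of coincidences), `gibbsKernel z Λ Y A = weight A / weight univ`;
* `IsGibbs z μ` — `μ` is a probability measure on configurations with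
  `μ A = ∫ γ_Λ(A|Y) μ(dY)` for all bounded measurable `Λ` and measurable `A` (the printed
  characterisation of `𝒢_𝒳(U_hc, z)`, boundary conditions unrestricted);
* `Richthammer2007_hardDisk : Prop` — THE NAMED FACT: every such `μ` is invariant under every
  translation `PointConfig.translate τ` (tree; measurable by `PointConfig.measurable_translate`).

## Sources

* T. Richthammer, *Translation-invariance of two-dimensional Gibbsian point processes*, Comm.
  Math. Phys. 274 (2007) 81–122, arXiv:0706.3637: §2 Theorem 1 (p. 4), Theorem 2 (p. 5), §3.1–3.3
  (pp. 6–7).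
* T. Richthammer, *Lower bound on the mean square displacement of particles in the hard disk
  model*, Comm. Math. Phys. 345 (2016) 1077–1099, arXiv:1504.08147: §1 (p. 3), §2 Theorem 1,
  Corollary 1 (pp. 4–5).
* X. Blanc, M. Lewin, *The crystallization conjecture: a review*, EMS Surv. Math. Sci. 2 (2015),
  §3.1 (arXiv pp. 16–18).
* F. Merkl, S. W. W. Rolles, *Spontaneous breaking of continuous rotational symmetry in two
  dimensions*, Electron. J. Probab. 14 (2009) 1705–1726, §1–2 (pp. 2–3), Theorem 2.1.
* B. I. Halperin, *On the Hohenberg–Mermin–Wagner theorem and its limitations*, J. Stat. Phys.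
  175 (2019) 521–529, arXiv:1812.00220, §2.1, §2.3.
* A. Giuliani, F. Theil, *Long range order in atomistic models for solids*, J. Eur. Math. Soc. 24
  (2022) 3505–3555, arXiv:1907.07923, §3.1 Theorem 3.1 (arXiv pp. 6–7).
* I. Jauslin, J. L. Lebowitz, *High-fugacity expansion, Lee–Yang zeros and order–disorder
  transitions in hard-core lattice systems*, Comm. Math. Phys. 364 (2018) 655–682,
  arXiv:1708.01912, §1 (arXiv p. 2) and the main theorem of §1 (arXiv p. 6).

## Barrier audit (D-0021, 2026-08-15): confirmed

The technique class is covered because the theorem quantifies over ALL DLR states of the planar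
model (Theorem 1: every boundary condition; Theorem 2: every tempered Gibbs measure), not over a
proof technique; later primary sources cite it as established and build on it ("in 2 dimensions,
crystalline states are ruled out by the Mermin-Wagner theorem [Ri07]" — Jauslin–Lebowitz 2018,
§1; "If the dimension is one or two then the existence of long-range positional order is prevented
by the Mermin-Wagner theorem … see also [FP81, ISV, Pf81, Rich]" — Giuliani–Theil 2022, §3.1;
"these results prevent Gibbs measures from having long-range positional order" — Gaál, §1, as
reviewed with [MR], [HMR], [Au] in Richthammer 2016, §1). The audit sharpened `evasions_known`
(ii)–(vi) and `scope_caveats` below; the statement `Richthammer2007_hardDisk` is unchanged.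

## Wording risks

* Only the Euclidean hard disc (the case `|.|_h = |.|₂` of Theorem 1) is formalised; general norms,
  and the smoothly approximable potentials of Theorem 2 (Lennard-Jones-type tails
  `|U(x)| ≤ k/|x|^{4+ε}` included, Lemma 2 (b)), are cited, not transcribed.
* `gibbsKernel z Λ Y` is the junk value `0` when `Y ∩ Λᶜ` itself violates the hard core at a pair
  meeting `Λ`… it cannot: `HardCoreIn Λ` only constrains pairs with a point in `Λ`, and
  `superpose` puts no point of `Y` in `Λ`; the `k = 0` term gives `weight univ ≥ 1`, so the
  normalisation is by a number in `[1, ∞]`; it is `< ∞` for bounded `Λ` (`∑ z^k λ(Λ)^k/k!`), not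
  re-proved here.
-/

noncomputable section

open MeasureTheory Set
open scoped ENNReal BigOperators

namespace Literature.Barriers.AtomisticToContinuum.HardDisk

/-- The plane. -/
local notation "E2" => EuclideanSpace ℝ (Fin 2)

/-! ### Configurations: superposition with a boundary condition -/

/-- The configuration `({x₁, …, x_k} ∩ Λ) ∪ (Y ∩ Λᶜ)`: `k` points thrown into `Λ`, superposed
with the boundary condition `Y` outside `Λ` (Richthammer 2007, §3.2, `X_Λ X̄_{Λᶜ}` and
`ν_Λ(·|X̄)`). [cite: Richthammer2007, §3.2 (p. 6)] -/
def superpose (Λ : Set E2) {k : ℕ} (x : Fin k → E2) (Y : Literature.Analysis.FunctionSpaces.PointConfig E2) : Literature.Analysis.FunctionSpaces.PointConfig E2 where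
  carrier := (Set.range x ∩ Λ) ∪ ((Y : Set E2) ∩ Λᶜ)
  finite_inter_isCompact K hK := by
    rw [Set.union_inter_distrib_right]
    refine ((Set.finite_range x).subset ?_).union ((Y.finite_inter_isCompact K hK).subset ?_)
    · exact fun p hp => hp.1.1
    · exact fun p hp => ⟨hp.1.1, hp.2⟩

/-- Membership in a superposition. [folklore] -/
theorem mem_superpose {Λ : Set E2} {k : ℕ} {x : Fin k → E2} {Y : Literature.Analysis.FunctionSpaces.PointConfig E2} {p : E2} :
    p ∈ superpose Λ x Y ↔ (p ∈ Set.range x ∧ p ∈ Λ) ∨ (p ∈ Y ∧ p ∉ Λ) := Iff.rfl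

/-- No point of the boundary condition inside `Λ` survives, and no thrown point outside `Λ`.
[cite: Richthammer2007, §3.2] -/
theorem mem_superpose_of_mem {Λ : Set E2} {k : ℕ} {x : Fin k → E2} {Y : Literature.Analysis.FunctionSpaces.PointConfig E2} {p : E2}
    (hp : p ∈ superpose Λ x Y) : (p ∈ Λ → p ∈ Set.range x) ∧ (p ∉ Λ → p ∈ Y) := by
  rcases hp with ⟨hx, hΛ⟩ | ⟨hY, hΛ⟩
  · exact ⟨fun _ => hx, fun h => absurd hΛ h⟩
  · exact ⟨fun h => absurd h hΛ, fun _ => hY⟩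

/-- **The hard-core constraint in `Λ`** (`e^{-H_Λ(X)} = 1` for the pure hard-core potential with
the Euclidean norm and diameter `1`): any two distinct points of `X`, at least one of which lies in
`Λ`, are at distance `> 1` (Richthammer 2007, §3.3: `H_Λ` sums `U` over the pairs `E_Λ(X)`
meeting `Λ`; `U_hc = ∞` on `|x| ≤ 1`, `0` beyond). [cite: Richthammer2007, §2 and §3.3 (pp. 4, 6–7)] -/
def HardCoreIn (Λ : Set E2) (X : Literature.Analysis.FunctionSpaces.PointConfig E2) : Prop :=
  ∀ p ∈ X, ∀ q ∈ X, p ≠ q → (p ∈ Λ ∨ q ∈ Λ) → 1 < dist p q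

/-- The global hard-core condition (all pairs): the set `𝒳𝒳` of hard-disc configurations
(Richthammer 2016, §2). [cite: Richthammer2016, §2 (p. 4)] -/
def IsHardCore (X : Literature.Analysis.FunctionSpaces.PointConfig E2) : Prop :=
  ∀ p ∈ X, ∀ q ∈ X, p ≠ q → 1 < dist p q

/-- A hard-disc configuration satisfies the constraint in every `Λ`. [folklore] -/
theorem IsHardCore.hardCoreIn {X : Literature.Analysis.FunctionSpaces.PointConfig E2} (h : IsHardCore X) (Λ : Set E2) :
    HardCoreIn Λ X := fun p hp q hq hpq _ => h p hp q hq hpq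

/-- The constraint in `Λ = univ` is the global one. [folklore] -/
theorem hardCoreIn_univ_iff {X : Literature.Analysis.FunctionSpaces.PointConfig E2} : HardCoreIn Set.univ X ↔ IsHardCore X :=
  ⟨fun h p hp q hq hpq => h p hp q hq hpq (Or.inl trivial), fun h => h.hardCoreIn _⟩

/-! ### The finite-volume Gibbs distributions of the hard-disc model -/

/-- The un-normalised finite-volume weight of an event `A` in `Λ` with boundary condition `Y` at
activity `z`:
`∑_{k ≥ 0} (z^k / k!) ∫_{Λ^k} 1_A(X) 1[HardCoreIn Λ X] dx₁⋯dx_k`, `X = superpose Λ x Y`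
(Richthammer 2007, §3.2–3.3: `∫ ν_Λ(dX|X̄) e^{-H_Λ(X)} z^{#X_Λ} 1_A(X)` up to the constant factor
`e^{-λ²(Λ)}`, which cancels upon normalisation). A lower Lebesgue integral in `ℝ≥0∞`.
[cite: Richthammer2007, §3.2–3.3 (pp. 6–7)] -/
def weight (z : ℝ) (Λ : Set E2) (Y : Literature.Analysis.FunctionSpaces.PointConfig E2) (A : Set (Literature.Analysis.FunctionSpaces.PointConfig E2)) : ℝ≥0∞ :=
  ∑' k : ℕ, ENNReal.ofReal (z ^ k / (Nat.factorial k)) *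
    ∫⁻ x : Fin k → E2,
      (A ∩ {X | HardCoreIn Λ X}).indicator 1 (superpose Λ x Y)
        ∂(Measure.pi fun _ : Fin k => (volume : Measure E2).restrict Λ)

/-- **The conditional Gibbs distribution** `γ_Λ(A|Y) = weight(A) / weight(univ)` of the hard-disc
model at activity `z` in the volume `Λ` with boundary condition `Y` (Richthammer 2007, §3.3,
`γ_Λ^{U,z}(A|X̄) = Z_Λ(X̄)⁻¹ ∫ ν_Λ(dX|X̄) e^{-H_Λ(X)} z^{#X_Λ} 1_A(X)`; Richthammer 2016, §2:
"a Poisson point process in `Λ` with intensity `z` conditioned on the event that any two points in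
`Λ` keep a distance of `≥ 1` and any point in `Λ` keeps a distance of `≥ 1` to `Y_{Λᶜ}`").
[cite: Richthammer2007, §3.3 (p. 7)] [cite: Richthammer2016, §2 (p. 4)] -/
def gibbsKernel (z : ℝ) (Λ : Set E2) (Y : Literature.Analysis.FunctionSpaces.PointConfig E2) (A : Set (Literature.Analysis.FunctionSpaces.PointConfig E2)) : ℝ≥0∞ :=
  weight z Λ Y A / weight z Λ Y Set.univ

/-- **Gibbs measures of the hard-disc model at activity `z`** (infinite volume, DLR): probability
measures `μ` on configurations with `μ(A) = ∫ γ_Λ(A|Y) μ(dY)` for every bounded measurable `Λ`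
and measurable `A` — "`μ ∈ 𝒢_𝒳(U,z) ⟺ (μ ⊗ γ_Λ^{U,z} = μ ∀ Λ ∈ ℬ²_b)`" with unrestricted
boundary conditions (`𝒳𝒳 = 𝒳`, admissible since `U_hc ≥ 0`).
[cite: Richthammer2007, §3.3 (p. 7, the displayed equivalence and (3.1))] -/
def IsGibbs (z : ℝ) (μ : Measure (Literature.Analysis.FunctionSpaces.PointConfig E2)) : Prop :=
  IsProbabilityMeasure μ ∧
    ∀ Λ : Set E2, MeasurableSet Λ → Bornology.IsBounded Λ →
      ∀ A : Set (Literature.Analysis.FunctionSpaces.PointConfig E2), MeasurableSet A → μ A = ∫⁻ Y, gibbsKernel z Λ Y A ∂μ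

/-! ### The named fact -/

/-- **BARRIER (AtomisticToContinuum / Crystallization): at positive temperature there is no
positional order in two dimensions — Richthammer's Theorem 1 for hard discs.** For every activity
`z > 0`, every Gibbs measure of the planar hard-disc model is invariant under all translations of
the plane. (Printed for an arbitrary norm `|.|_h`; here the Euclidean disc.)

* technique_class: positive-temperature equilibrium (DLR / Gibbs-measure, grand-canonical) arguments for crystalline order that are insensitive to the dimension — any derivation of a non-translation-invariant ("periodic", Blanc–Lewin's (3.4) with a lattice group `G ≠ ℝ^d`) Gibbs state from short-range pair interactions by a mechanism that would equally apply in `d = 2` [cite: BlancLewin2015, §3.1 (arXiv pp. 16–18)]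
* blocks: (i) the positive-temperature strengthening of `AtomisticToContinuum/Crystallization` in `d = 2` — the dimension where the `T = 0` statement IS proved (Theil 2006) — for hard discs at every activity (this fact) and for smoothly approximable pair potentials with a Ruelle bound, e.g. finite range, or `|U(x)| ≤ k/|x|^{4+ε}` tails [cite: Richthammer2007, §2 Theorem 2 and Lemma 2]; (ii) lifting the two-dimensional `T = 0` theorems to `T > 0` by continuity in `T`: "this shows that the phase transition occurs exactly at `T_c(ρ) = 0`" (`d = 1`, van Hove) and "there is no crystalline order in one and two-dimensional systems at positive temperature" [cite: BlancLewin2015, §3.1 (arXiv p. 18)]; "there is no proof of crystalline order at low, but positive temperature for any realistic continuum particle system" [cite: MerklRolles2009, §1 (p. 2)]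
* because: Mermin–Wagner mechanism for the continuous translation symmetry: in the box `[-n, n]²`, with any hard-core boundary condition, all particles within `√n` of the centre can be shifted by `δε√(log n)` by a bijection of configuration space preserving the hard core, at an entropic cost `μ(|log(φ φ̄)|) ≤ 120 δ²` independent of `n` [cite: Richthammer2016, §2 Theorem 1 (1)–(7)], whence a lower bound `(δ²ε²/32) log n` on the mean square displacement of any consistently labelled particle [cite: Richthammer2016, §2 Corollary 1] — "the hard disk model shows the same behaviour as the harmonic crystal" (Peierls) [cite: Richthammer2016, §1 (p. 3)]; infinite-volume Gibbs measures are therefore translation invariant [cite: Richthammer2007, §2 Theorem 1, §5]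
* evasions_known: (i) `T = 0` (the seed: Theil 2006 and the other two-dimensional ground-state theorems) [cite: BlancLewin2015, §2.3]; (ii) `d ≥ 3`: no translation-invariance theorem, and no proof of positional order "for any realistic particle system" [cite: Richthammer2016, §1 (arXiv p. 3)] [cite: MerklRolles2009, §1 (p. 2)] — but for a lattice-labelled atomistic elasticity model WITH dislocations (Ariza–Ortiz energy plus a dislocation-core term on the FCC lattice) positional long-range order at low temperature is PROVED, `lim inf_Λ c_{β,Λ}(v₀;x,y) ≥ e^{-C/β}(1 + O(log|x-y|/|x-y|))`, by a dimension-SENSITIVE mechanism (spin-wave factorisation and cluster expansion of the dislocation gas after Fröhlich–Spencer / Kennedy–King; "the assumption `d = 3` plays a key role"), the authors noting that in `d ≤ 2` positional order "is prevented by the Mermin-Wagner theorem" [cite: GiulianiTheil2021, §3.1 Theorem 3.1 (arXiv pp. 6–7)]; (iii) orientational instead of positional order: Mermin–Wagner-type theorems "are not applicable to spatial rotations in two dimensions", non-rotation-invariant hard-disc Gibbs measures at high activity are conjectured, and a lattice-indexed, defect-free planar model breaks rotational symmetry at low temperature [cite: MerklRolles2009, §1 and Theorem 2.1]; the same for models with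 defects and for near-lattice-constrained hard discs ([HMR], [G], [Au]), while for "any realistic particle system" it is open [cite: Richthammer2016, §1 (arXiv p. 3)]; long-range bond-orientational order is compatible with the theorem [cite: Halperin2019, §2.3]; (iv) long-range interactions: in `d = 1` phase transitions occur for potentials decaying like `1/|x|²`, and the one-dimensional jellium is crystallised at all temperatures [cite: BlancLewin2015, §3.1 (arXiv p. 18)]; in `d = 2` Theorem 2 needs a smooth majorant with `ψ`-dominated SECOND derivatives, `∫ ψ(x)|x|² dx < ∞` (smooth tails `O(|x|^{-2-ε})` via Lemma 2 (a), rough tails `|U(x)| ≤ k/|x|^{4+ε}` via Lemma 2 (b)), so planar Coulomb / log gases are outside its scope [cite: Richthammer2007, §2 Definition 1 and Lemma 2 (arXiv p. 4)]; (v) explicit breaking of the CONTINUOUS translation group: hard-core LATTICE gases in `d ≥ 2` (hard diamonds, hard hexagons, all "non-sliding" models) have `τ ≥ 2` crystalline extremal Gibbs states at high fugacity, `ρ₁^{(ν)}(x) = 1 + O(y)` on the sublattice `𝓛_ν` and `O(y)` off it (Peierls / Pirogov–Sinai), whereas "in 2 dimensions, crystalline states are ruled out by the Mermin-Wagner theorem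 [Ri07]" in the continuum and "the present techniques do not allow us to go to the continuum" [cite: JauslinLebowitz2018, §1 (arXiv p. 2) and main theorem (arXiv p. 6)]; (vi) vanishing-temperature regimes: joint limits `T → 0`, `ρ → 0` with `T log ρ → ν` give a gas of clusters converging to ground-state crystals "where things can be proved in any dimension" — statements about `T → 0`, not about a fixed `T > 0` [cite: BlancLewin2015, §3.1 (arXiv p. 18)]
* scope_caveats: translation invariance of all Gibbs measures excludes positional long-range order (periodic one-point densities; and, since extremal Gibbs measures are tail-trivial with short-range correlations [cite: Georgii2011, Theorem 7.7] and hard-core local particle numbers are bounded, also asymptotically periodic truncated pair correlations of extremal states) but NOT quasi-long-range order (power-law decay of positional correlations), which the theorem "sheds no light on" [cite: Halperin2019, §2.1], nor phase transitions / non-uniqueness of Gibbs measures as such, nor orientational order [cite: Halperin2019, §2.3]; it is an infinite-volume statement at FIXED activity `z < ∞` about DLR (grand-canonical) states of a CONTINUUM PAIR-interaction model: finite boxes are constrained only at the displacement scale `√(log n)` [cite: Richthammer2016, §2 Corollary 1 (arXiv p. 5)] (mesoscopic crystallinity under lattice boundary conditions is untouched), canonical infinite-volume states (Blanc–Lewin's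 (3.4) is canonical [cite: BlancLewin2015, §3.1 (arXiv p. 16)]) are reached only through equivalence of ensembles, many-body interactions are not printed, lattice discretisations are excluded (evasion (v)); formalised is the Euclidean hard disc only (Theorem 1 allows any norm; Theorem 2 any smoothly approximable standard potential with Ruelle bound, all TEMPERED Gibbs measures) [cite: Richthammer2007, §2]; nothing is asserted about `d = 3`, where translation invariance is open and positional order is proved only for the lattice-labelled dislocation model of evasion (ii)
* status: established (Richthammer 2007, Theorem 1, full proof §5; antecedents Fröhlich–Pfister 1981, 1986 for smooth potentials, as reviewed in [cite: Richthammer2007, §1] and [cite: BlancLewin2015, §3.1]; cited as established by [cite: JauslinLebowitz2018, §1], [cite: GiulianiTheil2021, §3.1], [cite: Richthammer2016, §1]; in the tree Theorem 1 is reduced to the finite-volume inequality (5.8), `Richthammer2007_hardDisk_of_ineq58`; barrier audit 2026-08-15: confirmed, no dissent found)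

[cite: Richthammer2007, §2 Theorem 1 (p. 4)] -/
def Richthammer2007_hardDisk : Prop :=
  ∀ z : ℝ, 0 < z → ∀ μ : Measure (Literature.Analysis.FunctionSpaces.PointConfig E2), IsGibbs z μ →
    ∀ τ : E2, μ.map (Literature.Analysis.FunctionSpaces.PointConfig.translate τ) = μ

/-! ### API -/

/-- Under the fact, Gibbs expectations are translation invariant: `∫ f(X + τ) μ(dX) = ∫ f dμ` for
measurable `f ≥ 0`. [cite: Richthammer2007, §2 Theorem 1] -/
theorem Richthammer2007_hardDisk.lintegral_translate (h : Richthammer2007_hardDisk) {z : ℝ}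
    (hz : 0 < z) {μ : Measure (Literature.Analysis.FunctionSpaces.PointConfig E2)} (hμ : IsGibbs z μ) (τ : E2)
    {f : Literature.Analysis.FunctionSpaces.PointConfig E2 → ℝ≥0∞} (hf : Measurable f) :
    ∫⁻ X, f (X.translate τ) ∂μ = ∫⁻ X, f X ∂μ := by
  conv_rhs => rw [← h z hz μ hμ τ]
  rw [lintegral_map hf (Literature.Analysis.FunctionSpaces.PointConfig.measurable_translate τ)]

/-- Under the fact, the one-point intensity measure `Λ ↦ 𝔼_μ N(Λ)` of a Gibbs measure is
translation invariant — no periodic, non-constant density profile (`k = 1` in Blanc–Lewin's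
(3.4)) can arise. [cite: Richthammer2007, §2 Theorem 1] [cite: BlancLewin2015, §3.1 (3.4)] -/
theorem Richthammer2007_hardDisk.intensity_translate (h : Richthammer2007_hardDisk) {z : ℝ}
    (hz : 0 < z) {μ : Measure (Literature.Analysis.FunctionSpaces.PointConfig E2)} (hμ : IsGibbs z μ) (τ : E2) {s : Set E2}
    (hs : MeasurableSet s) :
    ∫⁻ X, (X.count ((· + τ) ⁻¹' s) : ℝ≥0∞) ∂μ = ∫⁻ X, (X.count s : ℝ≥0∞) ∂μ := by
  have hm : Measurable fun X : Literature.Analysis.FunctionSpaces.PointConfig E2 => (X.count s : ℝ≥0∞) :=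
    measurable_from_top.comp (Literature.Analysis.FunctionSpaces.PointConfig.measurable_count hs)
  simpa only [Literature.Analysis.FunctionSpaces.PointConfig.count_translate] using h.lintegral_translate hz hμ τ hm

/-- The hard-core constraint only restricts pairs meeting `Λ`: a superposition with NO thrown
point satisfies it whatever the boundary condition (so the `k = 0` term of `weight z Λ Y univ`
is `1` and the normalisation in `gibbsKernel` is never `0/0`). [cite: Richthammer2007, §3.3] -/
theorem hardCoreIn_superpose_zero (Λ : Set E2) (x : Fin 0 → E2) (Y : Literature.Analysis.FunctionSpaces.PointConfig E2) :
    HardCoreIn Λ (superpose Λ x Y) := by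
  intro p hp q hq _ hpq
  have hp' := mem_superpose_of_mem hp
  have hq' := mem_superpose_of_mem hq
  rcases hpq with h | h
  · obtain ⟨i, -⟩ := hp'.1 h; exact i.elim0
  · obtain ⟨i, -⟩ := hq'.1 h; exact i.elim0

/-- Hence `weight z Λ Y univ ≥ 1` for `z ≥ 0`… indeed for every real `z` (`z⁰/0! = 1`).
[cite: Richthammer2007, §3.3 (positivity of the partition function "by considering the empty configuration")] -/
theorem one_le_weight_univ (z : ℝ) (Λ : Set E2) (Y : Literature.Analysis.FunctionSpaces.PointConfig E2) :
    1 ≤ weight z Λ Y Set.univ := by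
  unfold weight
  refine le_trans ?_ (ENNReal.le_tsum 0)
  have h1 : ENNReal.ofReal (z ^ 0 / (Nat.factorial 0)) = 1 := by simp
  rw [h1, one_mul]
  have hconst : (fun x : Fin 0 → E2 =>
      (Set.univ ∩ {X | HardCoreIn Λ X}).indicator (1 : Literature.Analysis.FunctionSpaces.PointConfig E2 → ℝ≥0∞) (superpose Λ x Y)) =
      fun _ => 1 := by
    funext x
    rw [Set.univ_inter, Set.indicator_of_mem (hardCoreIn_superpose_zero Λ x Y)]
    rfl
  rw [hconst, lintegral_const]
  simp

end Literature.Barriers.AtomisticToContinuum.HardDisk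

end
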